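import Mathlib
import Literature.MathematicalPhysics.QuantumLattice.WilsonDiracAP
import Summits.QuantumFields.QCD.Theses.WilsonQuarkChessboard
import Summits.QuantumFields.QCD.Theorems.QuarksAsStableActionUnquenchedChessboardBoundStubChessboard
import Summits.QuantumFields.QCD.Theorems.QuarksAsStableActionUnquenchedChessboardBoundStubAxisSwap
import Summits.QuantumFields.QCD.Theorems.QuarksAsStableActionCriticalLineDiamagnetismStubQuarkChessboardOfSchwarzAux1
import Summits.QuantumFields.QCD.Theorems.QuarksAsStableActionCriticalLineDiamagnetismStubQuarkChessboardOfSchwarzAux2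

/-!
# The quark chessboard from the background Schwarz inequality
(helper for crux stmt-QuantumFields-9734, line `Sketch`, stub `stub_quarkChessboard_of_schwarz`)

Item stmt-QuantumFields-10349 (`BackgroundSchwarz`: reflection positivity of the all-axes
antiperiodic `r = 1` Wilson determinant `det_AP` of a `U(N)` field across the time site-planes
`0 | L/2`, in Cauchy–Schwarz form) implies item stmt-QuantumFields-9306 (`QuarkChessboard`:
`‖det_AP U‖^(L⁴) ≤ ∏_c Re det_AP (tile c U)` with every tiling determinant real `≥ 0`) on even
four-tori `L ≥ 4`.  This is the Fröhlich–Israel–Lieb–Simon iteration (CMP 62 (1978), Thm. 4.3),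
available in the tree in abstract letter form
(`Theorems.UnquenchedChessboardBoundLine.stub_chessboard`), applied with: letters = the finite
alphabet `(ℤ/L)⁴ × (ℤ/2)⁴` (cell label, cube-reflection flags) with the commuting involutions
`r i (c, s) = (c, s + eᵢ)`, read into closed-unit-hypercube link data of `U` (auxiliary file 2);
`Φ w = Re det_AP (field of w)` on CONSISTENT words (adjacent cells agree on their common face) and
`0` otherwise.  Translation invariance of `Φ` is that of `det_AP` (seam relocation,
`fermionDet_wilsonDirac_apTwistAt`, `…_torusConfigShift`); reflection non-negativity and
Cauchy–Schwarz in axis `i` are item 10349 transported by the hypercubic covariance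
`AxisSwap.det_wilsonDirac_swap`, because the fields of the symmetrised words of a consistent word are
exactly the doubles `U⁺⁺`, `U⁻⁻` (auxiliary file 1, boundary planes included); the word `c ↦ (c, 0)`
has field `U`, the universal pattern of the letter `(c, 0)` has field the translate of `tile c U`,
and `|Re det_AP U| = ‖det_AP U‖` by reality of the Wilson determinant
(`fermionDet_wilsonDirac_im_holds`).  No definitions: all gadgets are local functions.
-/

noncomputable section

open scoped BigOperators Classical Matrix ComplexConjugate
open Finset
open Literature.MathematicalPhysics.QuantumLattice Literature.MathematicalPhysics.QuantumFieldTheory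
  Literature.Probability.LatticeModels

namespace Summit.QuantumFields.QCD.Cruxes.CriticalLineDiamagnetism.ChessboardCellGain

/-- **Stub `quarkChessboard_of_schwarz`**: the background Schwarz inequality (item
stmt-QuantumFields-10349) implies the cell-wise quark chessboard (item stmt-QuantumFields-9306), by the
Fröhlich–Israel–Lieb–Simon iteration over all translates and all four axes. -/
theorem stub_quarkChessboard_of_schwarz :
    Theses.WilsonQuarkChessboard.BackgroundSchwarz → Theses.WilsonQuarkChessboard.QuarkChessboard := by
  intro hBS N L _ hL h4 U m hm dAP tile
  -- the two `let`s of the item, as opaque local functions with their defining equations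
  have hdAP : ∀ V, dAP V = (wilsonDirac (unitaryFundamentalRep (Fin N) ℂ)
      (fun e => if (e.1 e.2).val + 1 = L then -V e else V e) m 1).det := fun V => rfl
  have htile : ∀ c V e, tile c V e = if (e.1 e.2 - c e.2).val % 2 = 0
      then V (fun ν => c ν + (((e.1 ν - c ν).val % 2 : ℕ) : ZMod L), e.2)
      else (V (fun ν => c ν +
        (((Literature.MathematicalPhysics.QuantumFieldTheory.Site.shift e.1 e.2 ν - c ν).val % 2 : ℕ) :
          ZMod L), e.2))⁻¹ := fun c V e => rfl
  clear_value dAP tile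
  -- the doubles of item 10349 in a general axis `i`
  obtain ⟨Dp, hDp⟩ : ∃ Dp : Fin 4 → GaugeConfig 4 L (Matrix.unitaryGroup (Fin N) ℂ) →
      GaugeConfig 4 L (Matrix.unitaryGroup (Fin N) ℂ), ∀ i V e, Dp i V e =
      if (if e.2 = i then (e.1 i).val < L / 2 else (e.1 i).val ≤ L / 2) then V e
      else if e.2 = i then (V (Function.update
          (Literature.MathematicalPhysics.QuantumFieldTheory.Site.shift e.1 i) i
          (-Literature.MathematicalPhysics.QuantumFieldTheory.Site.shift e.1 i i), i))⁻¹
        else V (Function.update e.1 i (-e.1 i), e.2) := ⟨_, fun _ _ _ => rfl⟩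
  obtain ⟨Dm, hDm⟩ : ∃ Dm : Fin 4 → GaugeConfig 4 L (Matrix.unitaryGroup (Fin N) ℂ) →
      GaugeConfig 4 L (Matrix.unitaryGroup (Fin N) ℂ), ∀ i V e, Dm i V e =
      if (if e.2 = i then (e.1 i).val < L / 2 else (e.1 i).val ≤ L / 2) then
        (if e.2 = i then (V (Function.update
          (Literature.MathematicalPhysics.QuantumFieldTheory.Site.shift e.1 i) i
          (-Literature.MathematicalPhysics.QuantumFieldTheory.Site.shift e.1 i i), i))⁻¹
        else V (Function.update e.1 i (-e.1 i), e.2))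
      else V e := ⟨_, fun _ _ _ => rfl⟩
  -- item 10349 in the time axis, folded, then in every axis
  have hBS0 : ∀ V, 0 ≤ (dAP (Dp 0 V)).re ∧ (dAP (Dp 0 V)).im = 0 ∧ 0 ≤ (dAP (Dm 0 V)).re ∧
      (dAP (Dm 0 V)).im = 0 ∧ ‖dAP V‖ ^ 2 ≤ (dAP (Dp 0 V)).re * (dAP (Dm 0 V)).re := by
    intro V
    have h := hBS N L hL h4 V m hm
    simpa only [hdAP, hDp, hDm] using h
  have hBSi := bs_axis m hdAP hDp hDm hBS0
  -- the encoding: letters, reflections, link readings, consistency, fields, the functional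
  obtain ⟨r, hr⟩ : ∃ r : Fin 4 → Site 4 L × (Fin 4 → ZMod 2) → Site 4 L × (Fin 4 → ZMod 2),
      ∀ i a, r i a = (a.1, a.2 + Pi.single i 1) := ⟨_, fun _ _ => rfl⟩
  obtain ⟨rd, hrd⟩ : ∃ rd : Site 4 L × (Fin 4 → ZMod 2) → (Fin 4 → ZMod 2) → Fin 4 →
      Matrix.unitaryGroup (Fin N) ℂ, ∀ a ε μ, rd a ε μ = if a.2 μ = 1 then
        (U (a.1 + fun ν => if ν = μ then 0 else (((ε ν + a.2 ν).val : ℕ) : ZMod L), μ))⁻¹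
      else U (a.1 + fun ν => if ν = μ then 0 else (((ε ν + a.2 ν).val : ℕ) : ZMod L), μ) :=
    ⟨_, fun _ _ _ => rfl⟩
  obtain ⟨Cons, hCons⟩ : ∃ Cons : (Site 4 L → Site 4 L × (Fin 4 → ZMod 2)) → Prop, ∀ w, Cons w ↔
      ∀ z j μ ε, μ ≠ j → ε j = 0 → rd (w z) (ε + Pi.single j 1) μ =
        rd (w (Literature.MathematicalPhysics.QuantumFieldTheory.Site.shift z j)) ε μ :=
    ⟨_, fun _ => Iff.rfl⟩
  obtain ⟨Fld, hFld⟩ : ∃ Fld : (Site 4 L → Site 4 L × (Fin 4 → ZMod 2)) →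
      GaugeConfig 4 L (Matrix.unitaryGroup (Fin N) ℂ), ∀ w e, Fld w e = rd (w e.1) 0 e.2 :=
    ⟨_, fun _ _ => rfl⟩
  obtain ⟨Φ, hΦ⟩ : ∃ Φ : (Site 4 L → Site 4 L × (Fin 4 → ZMod 2)) → ℝ, ∀ w, Φ w =
      if Cons w then (dAP (Fld w)).re else 0 := ⟨_, fun _ => rfl⟩
  have hri : ∀ i a ε, rd (r i a) ε i = (rd a ε i)⁻¹ := rd_r_same U hr hrd
  have hrn : ∀ i a ε μ, μ ≠ i → rd (r i a) ε μ = rd a (ε + Pi.single i 1) μ :=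
    fun i a ε μ hμ => rd_r_of_ne U hr hrd i a ε hμ
  -- reflection non-negativity: symmetrised words are reflection symmetric, their fields are doubles
  have posP : ∀ (i : Fin 4) (w : Site 4 L → Site 4 L × (Fin 4 → ZMod 2)),
      0 ≤ Φ (fun c => if (c i).val < L / 2 then w c
        else r i (w (Function.update c i (-1 - c i)))) := by
    intro i w
    rw [hΦ]
    split_ifs with hc
    · have e1 := fld_symP hri hrn hCons hFld hL hc i
      rw [symP_idem hL] at e1
      rw [e1.trans (funext fun e => (hDp i _ e).symm)]
      exact (hBSi i _).1
    · exact le_rfl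
  have posM : ∀ (i : Fin 4) (w : Site 4 L → Site 4 L × (Fin 4 → ZMod 2)),
      0 ≤ Φ (fun c => if (c i).val < L / 2 then r i (w (Function.update c i (-1 - c i)))
        else w c) := by
    intro i w
    rw [hΦ]
    split_ifs with hc
    · have e1 := fld_symM hri hrn hCons hFld hL hc i
      rw [symM_idem hL] at e1
      rw [e1.trans (funext fun e => (hDm i _ e).symm)]
      exact (hBSi i _).2.2.1
    · exact le_rfl
  -- reflection Cauchy–Schwarz
  have hcs : ∀ (i : Fin 4) (w : Site 4 L → Site 4 L × (Fin 4 → ZMod 2)),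
      Φ w ^ 2 ≤ Φ (fun c => if (c i).val < L / 2 then w c
          else r i (w (Function.update c i (-1 - c i)))) *
        Φ (fun c => if (c i).val < L / 2 then r i (w (Function.update c i (-1 - c i)))
          else w c) := by
    intro i w
    by_cases hc : Cons w
    · have eP := (fld_symP hri hrn hCons hFld hL hc i).trans (funext fun e => (hDp i _ e).symm)
      have eM := (fld_symM hri hrn hCons hFld hL hc i).trans (funext fun e => (hDm i _ e).symm)
      simp only [hΦ, if_pos hc, if_pos (cons_symP hri hrn hCons hL hc i),
        if_pos (cons_symM hri hrn hCons hL hc i), eP, eM]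
      refine le_trans ?_ (hBSi i (Fld w)).2.2.2.2
      rw [← sq_abs]
      exact pow_le_pow_left₀ (abs_nonneg _) (Complex.abs_re_le_norm _) 2
    · rw [hΦ w, if_neg hc, zero_pow two_ne_zero]
      exact mul_nonneg (posP i w) (posM i w)
  -- translation invariance
  have hcyc : ∀ (w : Site 4 L → Site 4 L × (Fin 4 → ZMod 2)) (v : Site 4 L),
      Φ (fun c => w (c + v)) = Φ w := by
    intro w v
    rw [hΦ, hΦ, fld_translate hFld, dAP_translate m hdAP]
    by_cases hc : Cons w
    · rw [if_pos hc, if_pos ((cons_translate_iff hCons w v).2 hc)]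
    · rw [if_neg hc, if_neg (mt (cons_translate_iff hCons w v).1 hc)]
  -- the abstract chessboard estimate
  obtain ⟨hpat, hprod⟩ := Theorems.UnquenchedChessboardBoundLine.stub_chessboard hL r
    (r_involutive hr) (r_comm hr) Φ hcyc posP hcs
  -- the universal pattern of the letter `(c, 0)` evaluates to `Re det_AP (tile c U)`
  have hΦpat : ∀ c : Site 4 L, Φ (fun x => (r 0)^[(x 0).val] ((r 1)^[(x 1).val] ((r 2)^[(x 2).val]
      ((r 3)^[(x 3).val] (c, 0))))) = (dAP (tile c U)).re := by
    intro c
    have hw : (fun x : Site 4 L => (r 0)^[(x 0).val] ((r 1)^[(x 1).val] ((r 2)^[(x 2).val]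
        ((r 3)^[(x 3).val] (c, 0))))) = fun x => (c, fun ν => (((x ν).val : ℕ) : ZMod 2)) :=
      funext fun x => pattern_eq hr c x
    have hc' : Cons (fun x => (c, fun ν => (((x ν).val : ℕ) : ZMod 2))) := by
      rw [hCons]
      intro z j μ ε hμ hε
      exact cons_pattern U hrd hL c z j μ ε hμ hε
    have hf : Fld (fun x => (c, fun ν => (((x ν).val : ℕ) : ZMod 2))) =
        fun e => tile c U (e.1 + c, e.2) := by
      funext e
      rw [hFld]
      exact fld_pattern U hrd hL htile c e.1 e.2
    rw [hw, hΦ, if_pos hc', hf, dAP_translate m hdAP]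
  -- the word of `U` evaluates to `Re det_AP U`
  have hcU : Cons (fun c => (c, 0)) := by
    rw [hCons]
    intro z j μ ε hμ hε
    exact cons_word U hrd z j μ ε hμ hε
  have hfU : Fld (fun c => (c, 0)) = U := by
    funext e
    rw [hFld]
    exact fld_word U hrd e.1 e.2
  have hΦU : Φ (fun c => (c, 0)) = (dAP U).re := by rw [hΦ, if_pos hcU, hfU]
  -- conclusion
  have him : ∀ V, (dAP V).im = 0 := dAP_im m hdAP
  refine ⟨fun c => ⟨le_of_le_of_eq (hpat (c, 0)) (hΦpat c), him _⟩, ?_⟩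
  have h2 := hprod (fun c => (c, 0))
  simp only [hΦU, hΦpat] at h2
  rwa [Complex.abs_re_eq_norm.2 (him U)] at h2

end Summit.QuantumFields.QCD.Cruxes.CriticalLineDiamagnetism.ChessboardCellGain

end
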